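import Summits.Ventures.YMGap.Thresholds.ZeroCouplingWilsonLoopAllGroups
import Literature.MathematicalPhysics.QuantumLattice.WilsonLoops
import Literature.MathematicalPhysics.QuantumFieldTheory.StrongCouplingActivities
import HarnessLib

/-!
# One-link Haar resampling for the holonomy of an ARBITRARY lattice walk traversing a link once (row type C-PERIMETER-G, walks)

Cell `pub-ymgap`, seat ds-1 (gen 16). HONEST FRAMING: elementary LATTICE geometry / Haar invariance for the walk holonomy
`walkHolonomy U w = ∏_{darts of w} U_e^{±1}` of `Literature/…/QuantumLattice/WilsonLoops.lean`: if the positively oriented link `e` is the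
underlying link of EXACTLY ONE dart of `w`, then after updating `U_e := g` the holonomy is `a·g·b` or `a·g⁻¹·b` with `a, b` free of `g`, so
integrating over `U_e` Haar-averages every function of the holonomy, and under `dg_∞` the holonomy is Haar distributed independently of every
continuous `Ψ` not seeing `e`. With `StrongCouplingCoveringBound` this yields the universal strong-coupling bound for the Wilson loop observable
`wilsonLoopObs χ w` of every closed walk without repeated links (`StrongCouplingPerimeterLawWalks`). Nothing about weak coupling, the continuum,
or the Clay problem. Kernel theorems only, 0 definitions, 0 compute.

* `dartHolonomy_update_of_ne`, `dartHolonomy_update_self`, `prod_map_dartHolonomy_update_of_not_mem`, ★ `prod_map_dartHolonomy_update_eq`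
  (lists of darts), ★ `walkHolonomy_update_eq`, `dependsOn_walkHolonomy`, `continuous_walkHolonomy`, ★ `integral_update_walkHolonomy`,
  ★ `integral_comp_walkHolonomy_mul_eq`.
-/

noncomputable section

open MeasureTheory ProbabilityTheory Set Filter Topology Finset
open scoped NNReal
open Literature.Probability.LatticeModels (zdGraph)
open Literature.MathematicalPhysics.QuantumLattice (LGConfig ZdEdge dartStep dartHolonomy walkHolonomy)
open Literature.MathematicalPhysics.QuantumFieldTheory hiding ZdEdge
open Literature.MathematicalPhysics.QuantumFieldTheory.AreaLaw (integrable_zdHaar_of_continuous)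

namespace Summit.Ventures.YMGap.ZeroCouplingSlope

section Walks

variable {d : ℕ} {G : Type*} [Group G]

/-- Updating a link other than the dart's own link does not change the dart holonomy. [folklore] -/
theorem dartHolonomy_update_of_ne (U : LGConfig d G) {e : ZdEdge d} (δ : (zdGraph d).Dart) (h : (dartStep δ).1 ≠ e) (g : G) :
    dartHolonomy (Function.update U e g) δ = dartHolonomy U δ := by
  simp only [dartHolonomy, Function.update_of_ne h]

/-- Updating the dart's own link to `g` makes the dart holonomy `g` or `g⁻¹` (by orientation). [folklore] -/
theorem dartHolonomy_update_self (U : LGConfig d G) (δ : (zdGraph d).Dart) (g : G) :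
    dartHolonomy (Function.update U (dartStep δ).1 g) δ = (if (dartStep δ).2 then g else g⁻¹) := by
  simp only [dartHolonomy, Function.update_self]

/-- A product of dart holonomies over a list of darts none of which runs along `e` does not see `U_e`. [folklore] -/
theorem prod_map_dartHolonomy_update_of_not_mem (U : LGConfig d G) {e : ZdEdge d} (g : G) :
    ∀ (l : List (zdGraph d).Dart), e ∉ l.map (fun δ => (dartStep δ).1) →
      (l.map (dartHolonomy (Function.update U e g))).prod = (l.map (dartHolonomy U)).prod
  | [], _ => by simp
  | δ :: l, h => by
    simp only [List.map_cons, List.mem_cons, not_or] at h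
    simp only [List.map_cons, List.prod_cons]
    rw [dartHolonomy_update_of_ne U δ (Ne.symm h.1) g, prod_map_dartHolonomy_update_of_not_mem U g l (by simpa using h.2)]

/-- ★ **A list of darts running along `e` exactly once**: after `U_e := g` the product of its dart holonomies is `a·g·b` or `a·g⁻¹·b` with
`a, b` independent of `g`. [folklore] -/
theorem prod_map_dartHolonomy_update_eq (U : LGConfig d G) {e : ZdEdge d} :
    ∀ (l : List (zdGraph d).Dart), e ∈ l.map (fun δ => (dartStep δ).1) → (l.map (fun δ => (dartStep δ).1)).Nodup →
      ∃ a b : G, (∀ g, (l.map (dartHolonomy (Function.update U e g))).prod = a * g * b) ∨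
        (∀ g, (l.map (dartHolonomy (Function.update U e g))).prod = a * g⁻¹ * b)
  | [], h, _ => by simp at h
  | δ :: l, hmem, hnd => by
    simp only [List.map_cons, List.nodup_cons] at hnd
    simp only [List.map_cons, List.mem_cons] at hmem
    by_cases hδ : (dartStep δ).1 = e
    · -- the head runs along `e`; the tail does not
      have htail : e ∉ l.map (fun δ => (dartStep δ).1) := hδ ▸ hnd.1
      refine ⟨1, (l.map (dartHolonomy U)).prod, ?_⟩
      by_cases hb : (dartStep δ).2
      · left; intro g
        simp only [List.map_cons, List.prod_cons, prod_map_dartHolonomy_update_of_not_mem U g l htail, one_mul]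
        rw [← hδ, dartHolonomy_update_self, if_pos hb]
      · right; intro g
        simp only [List.map_cons, List.prod_cons, prod_map_dartHolonomy_update_of_not_mem U g l htail, one_mul]
        rw [← hδ, dartHolonomy_update_self, if_neg hb]
    · have hmem' : e ∈ l.map (fun δ => (dartStep δ).1) := by
        rcases hmem with h | h
        · exact absurd h.symm hδ
        · simpa using h
      obtain ⟨a, b, hab⟩ := prod_map_dartHolonomy_update_eq U l hmem' hnd.2
      refine ⟨dartHolonomy U δ * a, b, ?_⟩
      rcases hab with h | h
      · left; intro g
        simp only [List.map_cons, List.prod_cons, h g, dartHolonomy_update_of_ne U δ hδ g, mul_assoc]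
      · right; intro g
        simp only [List.map_cons, List.prod_cons, h g, dartHolonomy_update_of_ne U δ hδ g, mul_assoc]

/-- ★ **The holonomy of a walk running along the link `e` exactly once, after `U_e := g`, is `a·g·b` or `a·g⁻¹·b`** with `a, b` free of `g`.
[folklore] -/
theorem walkHolonomy_update_eq (U : LGConfig d G) {x y : Literature.Probability.LatticeModels.Site d} (w : (zdGraph d).Walk x y)
    {e : ZdEdge d} (he : e ∈ w.darts.map (fun δ => (dartStep δ).1)) (hnd : (w.darts.map (fun δ => (dartStep δ).1)).Nodup) :
    ∃ a b : G, (∀ g, walkHolonomy (Function.update U e g) w = a * g * b) ∨ (∀ g, walkHolonomy (Function.update U e g) w = a * g⁻¹ * b) :=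
  prod_map_dartHolonomy_update_eq U w.darts he hnd

/-- The walk holonomy does not see a link along which the walk does not run. [folklore] -/
theorem walkHolonomy_update_of_not_mem (U : LGConfig d G) {x y : Literature.Probability.LatticeModels.Site d} (w : (zdGraph d).Walk x y)
    {e : ZdEdge d} (he : e ∉ w.darts.map (fun δ => (dartStep δ).1)) (g : G) :
    walkHolonomy (Function.update U e g) w = walkHolonomy U w :=
  prod_map_dartHolonomy_update_of_not_mem U g w.darts he

/-- The walk holonomy depends only on the links along which the walk runs. [folklore] -/
theorem dependsOn_walkHolonomy {x y : Literature.Probability.LatticeModels.Site d} (w : (zdGraph d).Walk x y) :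
    DependsOn (fun U : LGConfig d G => walkHolonomy U w) {e | e ∈ w.darts.map (fun δ => (dartStep δ).1)} := by
  intro U V h
  simp only [walkHolonomy]
  refine congrArg List.prod (List.map_congr_left fun δ hδ => ?_)
  have : U (dartStep δ).1 = V (dartStep δ).1 := h _ (List.mem_map.2 ⟨δ, hδ, rfl⟩)
  simp only [dartHolonomy, this]

variable [TopologicalSpace G] [IsTopologicalGroup G]

/-- The walk holonomy is continuous in the configuration. [folklore] -/
theorem continuous_walkHolonomy {x y : Literature.Probability.LatticeModels.Site d} (w : (zdGraph d).Walk x y) :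
    Continuous fun U : LGConfig d G => walkHolonomy U w := by
  have hδ : ∀ δ : (zdGraph d).Dart, Continuous fun U : LGConfig d G => dartHolonomy U δ := fun δ => by
    unfold dartHolonomy
    split_ifs
    · exact continuous_apply _
    · exact (continuous_apply _).inv
  have : ∀ l : List (zdGraph d).Dart, Continuous fun U : LGConfig d G => (l.map (dartHolonomy U)).prod := by
    intro l
    induction l with
    | nil => simpa using continuous_const
    | cons δ l ih =>
      simp only [List.map_cons, List.prod_cons]
      exact (hδ δ).mul ih
  exact this w.darts

variable [CompactSpace G] [MeasurableSpace G] [BorelSpace G]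

/-- ★ **Haar invariance over one link of a walk**: if the walk runs along `e` exactly once, integrating any function of its holonomy over
`U_e` gives the Haar average. [folklore] -/
theorem integral_update_walkHolonomy {E : Type*} [NormedAddCommGroup E] [NormedSpace ℝ E] (Φ : G → E)
    {x y : Literature.Probability.LatticeModels.Site d} (w : (zdGraph d).Walk x y) {e : ZdEdge d}
    (he : e ∈ w.darts.map (fun δ => (dartStep δ).1)) (hnd : (w.darts.map (fun δ => (dartStep δ).1)).Nodup) (U : LGConfig d G) :
    ∫ g, Φ (walkHolonomy (Function.update U e g) w) ∂haarProbability G = ∫ g, Φ g ∂haarProbability G := by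
  obtain ⟨a, b, h | h⟩ := walkHolonomy_update_eq U w he hnd
  · simp_rw [h]; exact integral_haar_conj_eq Φ a b
  · simp_rw [h]; exact integral_haar_conj_inv_eq Φ a b

variable [SecondCountableTopology G]

/-- ★ **Resampling a link of the walk that `Ψ` ignores**: if the walk runs along `e` exactly once and the continuous `Ψ` does not depend on
`U_e`, then under `dg_∞` the walk holonomy is Haar distributed INDEPENDENTLY of `Ψ`:
`∫ Φ(hol_w) Ψ dg_∞ = (∫ Φ dHaar) · ∫ Ψ dg_∞`. [folklore] -/
theorem integral_comp_walkHolonomy_mul_eq {Φ : G → ℝ} (hΦ : Continuous Φ) {x y : Literature.Probability.LatticeModels.Site d}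
    (w : (zdGraph d).Walk x y) {e : ZdEdge d} (he : e ∈ w.darts.map (fun δ => (dartStep δ).1))
    (hnd : (w.darts.map (fun δ => (dartStep δ).1)).Nodup) {Ψ : LGConfig d G → ℝ} (hΨ : Continuous Ψ)
    (hΨe : ∀ (U : LGConfig d G) (g : G), Ψ (Function.update U e g) = Ψ U) :
    ∫ U, Φ (walkHolonomy U w) * Ψ U ∂zdHaar d G = (∫ g, Φ g ∂haarProbability G) * ∫ U, Ψ U ∂zdHaar d G := by
  classical
  have hint : Integrable (fun U : LGConfig d G => Φ (walkHolonomy U w) * Ψ U) (zdHaar d G) :=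
    integrable_zdHaar_of_continuous ((hΦ.comp (continuous_walkHolonomy w)).mul hΨ)
  have hupd : ∀ U : LGConfig d G,
      ∫ g, Φ (walkHolonomy (Function.update U e g) w) ∂haarProbability G = ∫ g, Φ g ∂haarProbability G :=
    fun U => integral_update_walkHolonomy Φ w he hnd U
  rw [zdHaar, Literature.Probability.LatticeModels.integral_infinitePi_eq_integral_update
    (fun _ : Literature.MathematicalPhysics.QuantumLattice.ZdEdge d => haarProbability G) e hint]
  simp_rw [hΨe, integral_mul_const, hupd]
  rw [integral_const_mul]

end Walks

end Summit.Ventures.YMGap.ZeroCouplingSlope
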